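import Summits.BirchSwinnertonDyer.Rank1Residual.AdditivePotMult.PStarTwistModel
import Literature.NumberTheory.EllipticCurves.QuadraticTwistLocalPolynomialTwoProofs
import Literature.NumberTheory.EllipticCurves.LeadingTermBSZOrdinaryProofs
import HarnessLib

/-!
# Additive reduction at an odd prime `p` is preserved by a quadratic twist by a `p`-adic UNIT
# (input ADDV-UNIT-TWIST of the Kosters–Pannekoek repair of TDS57, stmt-BirchSwinnertonDyer-22227, DISCHARGED)

Cell `pub/bsd-wall` (D-0145 line `route-BirchSwinnertonDyer-EdixhovenFibreFiveSeven`), seat `bsd-line-edix-p2`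
(prover). THEOREMS ONLY; route-free. The sibling file
`Theorems/EdixhovenFibreFiveSevenTwistDegreeStepFiveSevenKP.lean` proves TDS57 by name from F″ and three
spelled-out inputs; the third, ADDV-UNIT-TWIST ("`Addv W p` and `ord_p u = 0` ⟹ `Addv (C • W^{(u)}) p`"), is
proved here — so only L-TWIST (⟸ Ihara) and TORS-TWIST (elementary Galois) remain.

* `good_quadraticTwist_of_padicValRat_eq_zero` — good reduction at the odd prime `p` survives the twist by a
  `p`-adic unit `u`: the `ℤ_p`-minimal equation twisted by the unit is `ℤ_p`-minimal with the same `v(Δ)`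
  (tree `isMinimal_quadraticTwist`, `hasGoodReduction_quadraticTwist_iff`), and good reduction is read off any
  `ℚ_p`-isomorphic minimal equation (`hasGoodReduction_iff_of_isMinimal_of_eq_smul`) — the proof of the
  tree's `AdditivePotMult.mult_quadraticTwist_of_padicValRat_eq_zero` VERBATIM with "multiplicative" replaced
  by "good". [Silverman AEC VII.5 Prop. 5.1(a), VII.1 Prop. 1.3(b)]
* `addv_of_model_unit_twist` — additive = neither good nor multiplicative; if a model `Wd = C • W^{(u)}` of the
  twist were good (resp. multiplicative) at `p`, so would be its own unit twist `Wd^{(u)} ≅ W^{(u²)} ≅ W`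
  (`exists_quadraticTwist_quadraticTwist_eq_smul`, `quadraticTwist_smul`, `hasGoodReductionAtPrime_smul_iff`,
  `hasMultiplicativeReductionAtPrime_smul_iff`), contradicting `Addv W p`.
* `addv_of_model_twist_auxPrime` — the instance used by the repair: `u = q* = (−1)^{(q−1)/2} q` for a prime
  `q ≠ p`, `p` odd (`ord_p q* = 0`).

References: [SilvermanAEC2009] VII.1 Prop. 1.3(b), VII.5 Prop. 5.1, X.5 Cor. 5.4.
-/

set_option autoImplicit false
-- the Theorems directory repeats the summit name (sibling precedent `SignedBaseChangeAssembly.lean`)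
set_option linter.dupNamespace false

noncomputable section

open scoped Classical

open WeierstrassCurve Literature.NumberTheory.EllipticCurves
  Literature.NumberTheory.EllipticCurves.Rank1Residual
  Summit.BirchSwinnertonDyer.Rank1Residual Summit.BirchSwinnertonDyer.Rank1Residual.AdditivePotMult

namespace Summit.BirchSwinnertonDyer.BirchSwinnertonDyer.Theorems.AddvUnitTwist

variable {W : WeierstrassCurve ℚ} [W.IsElliptic] {p : ℕ} [hp : Fact p.Prime]

omit [W.IsElliptic] in
/-- **A quadratic twist by a `p`-adic unit preserves GOOD reduction at the odd prime `p`.** If `E/ℚ` is good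
at `p ≠ 2` and `u ∈ ℚ^×` has `ord_p u = 0`, then `E^{(u)}` is good at `p` (the port of
`AdditivePotMult.mult_quadraticTwist_of_padicValRat_eq_zero`: the unit twist of the `ℤ_p`-minimal equation is
minimal with the same `v(Δ)`). [cite: SilvermanAEC2009, VII.5 Prop. 5.1(a) and VII.1 Prop. 1.3(b)] -/
theorem good_quadraticTwist_of_padicValRat_eq_zero (hp2 : p ≠ 2) {u : ℚ} (hu0 : u ≠ 0)
    (hu : padicValRat p u = 0) (hg : W.HasGoodReductionAtPrime p) :
    (W.quadraticTwist u).HasGoodReductionAtPrime p := by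
  -- `u` is a `p`-adic unit
  have hnorm : ‖((u : ℚ) : ℚ_[p])‖ = 1 := by
    rw [Padic.eq_padicNorm, padicNorm.eq_zpow_of_nonzero hu0, hu, neg_zero, zpow_zero,
      Rat.cast_one]
  set x : ℤ_[p] := ⟨((u : ℚ) : ℚ_[p]), hnorm.le⟩ with hx
  have hxu : IsUnit x := PadicInt.isUnit_iff.mpr (by rw [hx, PadicInt.norm_def]; exact hnorm)
  set d : ℤ_[p]ˣ := hxu.unit with hd
  have hdK : algebraMap ℤ_[p] ℚ_[p] (d : ℤ_[p]) = ((u : ℚ) : ℚ_[p]) := by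
    rw [hd, IsUnit.unit_spec, hx]; rfl
  have h2 : IsUnit (2 : ℤ_[p]) := WeierstrassCurve.isUnit_two_padicInt hp2
  -- the minimal model `X₁` of `E ⊗ ℚ_p` and its unit twist
  set X : WeierstrassCurve ℚ_[p] := W.baseChange ℚ_[p] with hXdef
  set D₁ : VariableChange ℚ_[p] := (X.exists_isMinimal ℤ_[p]).choose with hD₁
  have h₁ : X.minimal ℤ_[p] = D₁ • X := rfl
  haveI hmin : IsMinimal ℤ_[p] ((X.minimal ℤ_[p]).quadraticTwist (algebraMap ℤ_[p] ℚ_[p] (d : ℤ_[p]))) :=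
    isMinimal_quadraticTwist ℤ_[p] (X.minimal ℤ_[p]) h2 d
  have hg₁ : ((X.minimal ℤ_[p]).quadraticTwist
      (algebraMap ℤ_[p] ℚ_[p] (d : ℤ_[p]))).HasGoodReduction ℤ_[p] :=
    (hasGoodReduction_quadraticTwist_iff (R := ℤ_[p])).mpr hg
  -- `E^{(u)} ⊗ ℚ_p = (D₁⁻¹ • X₁)^{(u)} = C' • X₁^{(u)}`
  set Y : WeierstrassCurve ℚ_[p] := (W.quadraticTwist u).baseChange ℚ_[p] with hYdef
  have hXback : X = D₁⁻¹ • X.minimal ℤ_[p] := by rw [h₁, smul_smul, inv_mul_cancel, one_smul]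
  have hY : Y = (⟨D₁⁻¹.u, ((u : ℚ) : ℚ_[p]) * D₁⁻¹.r, 0, 0⟩ : VariableChange ℚ_[p]) •
      (X.minimal ℤ_[p]).quadraticTwist (algebraMap ℤ_[p] ℚ_[p] (d : ℤ_[p])) := by
    rw [hYdef, baseChange, map_quadraticTwist, ← baseChange, ← hXdef, hdK, eq_ratCast]
    conv_lhs => rw [hXback]
    rw [quadraticTwist_smul]
  set D₂ : VariableChange ℚ_[p] := (Y.exists_isMinimal ℤ_[p]).choose with hD₂
  have h₂ : Y.minimal ℤ_[p] = D₂ • Y := rfl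
  have h : Y.minimal ℤ_[p] =
      (D₂ * ⟨D₁⁻¹.u, ((u : ℚ) : ℚ_[p]) * D₁⁻¹.r, 0, 0⟩) •
        (X.minimal ℤ_[p]).quadraticTwist (algebraMap ℤ_[p] ℚ_[p] (d : ℤ_[p])) := by
    rw [h₂, hY, mul_smul]
  unfold HasGoodReductionAtPrime
  rw [← hYdef]
  exact (hasGoodReduction_iff_of_isMinimal_of_eq_smul ℤ_[p] h).mpr hg₁

/-- **Additive reduction at the odd prime `p` is preserved by any `ℚ`-model of a `p`-adic-unit twist.** If `E`
is additive at `p` (neither good nor multiplicative), `ord_p u = 0`, and `Wd = C • E^{(u)}`, then `Wd` is additive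
at `p`: were `Wd` good (resp. multiplicative), so would be `Wd^{(u)} ≅ E^{(u²)} ≅ E`. [cite: SilvermanAEC2009, VII.5 Prop. 5.1 and X.5 Cor. 5.4] -/
theorem addv_of_model_unit_twist (hp2 : p ≠ 2) {u : ℚ} (hu0 : u ≠ 0) (hu : padicValRat p u = 0)
    (hadd : Addv W p) {Wd : WeierstrassCurve ℚ} [Wd.IsElliptic]
    (hWd : ∃ C : VariableChange ℚ, C • W.quadraticTwist u = Wd) : Addv Wd p := by
  obtain ⟨C, rfl⟩ := hWd
  obtain ⟨D, hD⟩ := exists_quadraticTwist_quadraticTwist_eq_smul W hu0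
  -- `(C • W^{(u)})^{(u)} = (C' * D) • W`
  have key : (C • W.quadraticTwist u).quadraticTwist u =
      ((⟨C.u, u * C.r, 0, 0⟩ : VariableChange ℚ) * D) • W := by
    rw [mul_smul, ← hD, quadraticTwist_smul]
  refine ⟨fun hg ↦ hadd.1 ?_, fun hm ↦ hadd.2 ?_⟩
  · have h := good_quadraticTwist_of_padicValRat_eq_zero hp2 hu0 hu hg
    rw [key] at h
    exact (BSZLemma17.hasGoodReductionAtPrime_smul_iff W _ p).mp h
  · have h := mult_quadraticTwist_of_padicValRat_eq_zero hp2 hu0 hu hm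
    rw [key] at h
    exact (BSZLemma17.hasMultiplicativeReductionAtPrime_smul_iff W _ p).mp h

/-- **ADDV-UNIT-TWIST for the auxiliary prime of the repair**: for primes `q ≠ p`, `p` odd, and `W` additive at
`p`, every `ℚ`-model `v • W^{(q*)}` of the twist by `q* = (−1)^{(q−1)/2} q` is additive at `p` (`ord_p q* = 0`).
This discharges, at every odd `p` (in particular `p ∈ {5, 7}`), the hypothesis `hAT` of
`TwistDegreeStepFiveSevenKP.twistDegreeStepFiveSeven_of_kato_of_unitTwistInputs`. [cite: SilvermanAEC2009, VII.5 Prop. 5.1] -/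
theorem addv_of_model_twist_auxPrime (hp2 : p ≠ 2) {q : ℕ} (hq : q.Prime) (hqp : q ≠ p) (hadd : Addv W p)
    {Wd : WeierstrassCurve ℚ} [Wd.IsElliptic]
    (hWd : ∃ v : VariableChange ℚ, v • W.quadraticTwist (((-1 : ℤ) ^ (q / 2) * q : ℤ) : ℚ) = Wd) :
    Addv Wd p := by
  have hpP : p.Prime := hp.out
  have hq0 : (q : ℚ) ≠ 0 := by exact_mod_cast hq.ne_zero
  have hd0 : ((((-1 : ℤ) ^ (q / 2) * q : ℤ)) : ℚ) ≠ 0 := by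
    push_cast
    exact mul_ne_zero (pow_ne_zero _ (by norm_num)) hq0
  have hpq : ¬ p ∣ q := fun h ↦ hqp ((Nat.prime_dvd_prime_iff_eq hpP hq).mp h).symm
  have hvalq : padicValRat p (q : ℚ) = 0 := by
    rw [padicValRat.of_nat]
    exact_mod_cast padicValNat.eq_zero_of_not_dvd hpq
  have hval : padicValRat p ((((-1 : ℤ) ^ (q / 2) * q : ℤ)) : ℚ) = 0 := by
    push_cast
    rw [padicValRat.mul (pow_ne_zero _ (by norm_num)) hq0, padicValRat.pow,
      padicValRat.neg, padicValRat.one, mul_zero, zero_add, hvalq]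
  exact addv_of_model_unit_twist hp2 hd0 hval hadd hWd

end Summit.BirchSwinnertonDyer.BirchSwinnertonDyer.Theorems.AddvUnitTwist

end
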